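import Mathlib
import Literature.NumberTheory.Transcendental.KZDominatedFamilyRelations
import Literature.NumberTheory.Transcendental.KZLogCalculusProofs
import Literature.NumberTheory.Transcendental.SemialgebraicMapsProofs
import Literature.NumberTheory.Transcendental.SemialgebraicLineDeriv

/-!
# `TateLifting` (stmt-KontsevichZagierPeriods-9129), line `Sketch` — stub 46: REVOLUTION BAND

In the rotation sector of the line, an integrand-`1` solid of revolution
`σ = {(v, y, z) | v ∈ τ, α(v)² ≤ y² + z² ≤ β(v)²}` (`0 ≤ α ≤ β` two `ℚ`-semialgebraic functions on a
`ℚ`-semialgebraic base `τ ⊆ ℝⁿ`) is reduced by the rotation engine (stubs 44/45) to its MERIDIAN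
`m = [M, 2ρ]`, `M = {(v, ρ) | v ∈ τ, ρ > 0, α v ≤ ρ ≤ β v}` (base coordinates `Fin.init p`, fibre
coordinate `ρ = p (Fin.last n)`). This file proves `tateLifting_revolutionBand`: the honest base
representation `b = [τ, β² − α²]` EXISTS and `[m] − [b] ∈ KZ.relations`.

* The BAND `B = {(v, ρ) | v ∈ τ, α v ≤ ρ ≤ β v} = KZlog.band τ α β` carries the honest representation
  `mB = [B, 2ρ]`: `B ∖ M ⊆ {ρ = 0}` is null (`α ≥ 0`), so `2ρ` is integrable on `B = M ∪ (B ∖ M)`, and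
  `[mB] − [m] ∈ relations` (split off the null piece, `KZ.IntegralRep.of_sub_of_restrict_mem_relations`,
  then congruence of integrands on `M`, `KZ.of_sub_of_mem_relations_of_eqOn`).
* ONE Newton–Leibniz move (`KZ.newtonLeibnizRel`, rule (3)) along `ρ` with the primitive
  `F (v, ρ) = ρ²` (`∂F/∂ρ = 2ρ`, `F (v, β v) − F (v, α v) = β v² − α v²`) gives `[mB] − [b] ∈ relations`.
* HONESTY of `b`: `β² − α² ≥ 0` is absolutely integrable on `τ` because, by Tonelli along the last
  coordinate (`ℝⁿ⁺¹ ≃ ℝ × ℝⁿ` through the volume-preserving `MeasurableEquiv.piFinSuccAbove`, whose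
  inverse is `(t, x) ↦ Fin.snoc x t`), `∫⁻_τ (β² − α²) = ∫⁻_B 2ρ < ∞`, the fibre integral being
  `∫_{α v}^{β v} 2ρ dρ = β v² − α v²`.

References: M. Kontsevich, D. Zagier, *Periods* (2001), §1.2 rules (1), (3) ("Newton–Leibniz").
-/

noncomputable section

open MeasureTheory Set
open scoped ENNReal
open Literature.NumberTheory.Transcendental
open Literature.ModelTheory.ExponentialFields (IsSemialgebraic)

namespace Summit.KontsevichZagierPeriods.InverseLandau

namespace RevolutionBand

variable {n : ℕ}

/-- **Tonelli along the last coordinate, with a weight.** For a measurable `A ⊆ ℝⁿ⁺¹` and a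
measurable weight `W ≥ 0`, `∫⁻_A W` is the lower integral over the base `ℝⁿ` of the weighted lengths
of the vertical fibres `{t | Fin.snoc x t ∈ A}` (transport along the volume-preserving
`MeasurableEquiv.piFinSuccAbove _ (Fin.last n)` and `MeasureTheory.lintegral_prod_symm`). [folklore] -/
theorem setLIntegral_eq_lintegral_fibre {A : Set (Fin (n + 1) → ℝ)} (hA : MeasurableSet A)
    {W : (Fin (n + 1) → ℝ) → ℝ≥0∞} (hW : Measurable W) :
    ∫⁻ p in A, W p = ∫⁻ x : Fin n → ℝ,
      ∫⁻ t in {t : ℝ | (Fin.snoc x t : Fin (n + 1) → ℝ) ∈ A}, W (Fin.snoc x t) := by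
  set e : (Fin (n + 1) → ℝ) ≃ᵐ ℝ × (Fin n → ℝ) :=
    MeasurableEquiv.piFinSuccAbove (fun _ => ℝ) (Fin.last n) with he_def
  have he : MeasurePreserving e volume (volume.prod volume) :=
    volume_preserving_piFinSuccAbove (fun _ => ℝ) (Fin.last n)
  have hsymm : ∀ p : ℝ × (Fin n → ℝ), e.symm p = Fin.snoc p.2 p.1 := fun p => by
    rw [he_def, MeasurableEquiv.piFinSuccAbove_symm_apply, Fin.insertNthEquiv_last]
    rfl
  have hsnoc : ∀ x : Fin n → ℝ, Measurable fun t : ℝ => (Fin.snoc x t : Fin (n + 1) → ℝ) :=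
    fun x => (continuous_const.finSnoc continuous_id).measurable
  rw [← lintegral_indicator hA, ← (he.symm e).lintegral_comp_emb e.symm.measurableEmbedding,
    lintegral_prod_symm (fun q => A.indicator W (e.symm q))
      ((hW.indicator hA).comp e.symm.measurable).aemeasurable]
  refine lintegral_congr fun x => ?_
  have hfm : MeasurableSet {t : ℝ | (Fin.snoc x t : Fin (n + 1) → ℝ) ∈ A} :=
    hA.preimage (hsnoc x)
  rw [← lintegral_indicator hfm]
  refine lintegral_congr fun t => ?_
  rw [hsymm]
  dsimp only
  have hiff : t ∈ {t : ℝ | (Fin.snoc x t : Fin (n + 1) → ℝ) ∈ A} ↔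
      (Fin.snoc x t : Fin (n + 1) → ℝ) ∈ A := Iff.rfl
  by_cases h : (Fin.snoc x t : Fin (n + 1) → ℝ) ∈ A
  · rw [indicator_of_mem h, indicator_of_mem (hiff.2 h)]
  · rw [indicator_of_notMem h, indicator_of_notMem fun h' => h (hiff.1 h')]

/-- `∫⁻_{[a, b]} 2t dt = b² − a²` for `0 ≤ a ≤ b` (fundamental theorem of calculus, `integral_id`).
[folklore] -/
theorem lintegral_two_mul_Icc {a b : ℝ} (ha : 0 ≤ a) (hab : a ≤ b) :
    ∫⁻ t in Icc a b, ENNReal.ofReal (2 * t) = ENNReal.ofReal (b ^ 2 - a ^ 2) := by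
  have hint : IntegrableOn (fun t : ℝ => 2 * t) (Icc a b) :=
    (continuous_const.mul continuous_id).integrableOn_Icc
  rw [← ofReal_integral_eq_lintegral_ofReal hint
      ((ae_restrict_mem measurableSet_Icc).mono fun t ht => by
        show (0 : ℝ) ≤ 2 * t
        linarith [ht.1]),
    integral_Icc_eq_integral_Ioc, ← intervalIntegral.integral_of_le hab,
    intervalIntegral.integral_const_mul, integral_id]
  congr 1
  ring

/-- **The weighted area of a band.** For a measurable band
`B = {z | init z ∈ τ ∧ α (init z) ≤ z last ≤ β (init z)}` over a measurable base `τ` with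
`0 ≤ α ≤ β` on `τ`, `∫⁻_τ (β² − α²) = ∫⁻_B 2ρ` (Tonelli along the last coordinate; the fibre over
`x ∈ τ` is `[α x, β x]`, of weighted length `β x² − α x²`). [folklore] -/
theorem lintegral_sq_sub_sq_eq {τ : Set (Fin n → ℝ)} (hτm : MeasurableSet τ)
    {α β : (Fin n → ℝ) → ℝ} (hα0 : ∀ x ∈ τ, 0 ≤ α x) (hαβ : ∀ x ∈ τ, α x ≤ β x)
    {B : Set (Fin (n + 1) → ℝ)} (hBm : MeasurableSet B)
    (hB : B = {z | (Fin.init z : Fin n → ℝ) ∈ τ ∧ α (Fin.init z) ≤ z (Fin.last n) ∧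
      z (Fin.last n) ≤ β (Fin.init z)}) :
    ∫⁻ x in τ, ENNReal.ofReal (β x ^ 2 - α x ^ 2) =
      ∫⁻ p in B, ENNReal.ofReal (2 * p (Fin.last n)) := by
  have hmem : ∀ (x : Fin n → ℝ) (t : ℝ),
      (Fin.snoc x t : Fin (n + 1) → ℝ) ∈ B ↔ x ∈ τ ∧ t ∈ Icc (α x) (β x) := by
    intro x t
    rw [hB]
    simp only [mem_setOf_eq, Fin.init_snoc, Fin.snoc_last, mem_Icc]
  have hW : Measurable fun p : Fin (n + 1) → ℝ => ENNReal.ofReal (2 * p (Fin.last n)) :=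
    (measurable_const.mul (measurable_pi_apply (Fin.last n))).ennreal_ofReal
  rw [setLIntegral_eq_lintegral_fibre hBm hW, ← lintegral_indicator hτm]
  refine lintegral_congr fun x => ?_
  by_cases hx : x ∈ τ
  · rw [indicator_of_mem hx]
    have hfib : {t : ℝ | (Fin.snoc x t : Fin (n + 1) → ℝ) ∈ B} = Icc (α x) (β x) := by
      ext t
      simp only [mem_setOf_eq, hmem, hx, true_and]
    rw [hfib]
    simp only [Fin.snoc_last]
    exact (lintegral_two_mul_Icc (hα0 x hx) (hαβ x hx)).symm
  · rw [indicator_of_notMem hx]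
    have hfib : {t : ℝ | (Fin.snoc x t : Fin (n + 1) → ℝ) ∈ B} = ∅ := by
      ext t
      simp only [mem_setOf_eq, hmem, hx, false_and, mem_empty_iff_false]
    rw [hfib, Measure.restrict_empty, lintegral_zero_measure]

end RevolutionBand

/-- **Revolution band: the meridian of a solid of revolution of a band is one Newton–Leibniz move away
from its base representation.** Let `τ ⊆ ℝⁿ` be `ℚ`-semialgebraic, `0 ≤ α ≤ β` two `ℚ`-semialgebraic
functions on `τ`, and `m` an integral representation of dimension `n + 1` whose domain is the punctured
band `M = {p | init p ∈ τ ∧ 0 < p last ∧ α (init p) ≤ p last ≤ β (init p)}` and whose integrand is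
`2 · p last` on `M`. Then the base representation `b = [τ, β² − α²]` EXISTS as an honest integral
representation (its integrand is absolutely integrable because `∫_τ (β² − α²) = ∫_B 2ρ < ∞`, Tonelli
over the full band `B = {init p ∈ τ ∧ α (init p) ≤ p last ≤ β (init p)}`) and `[m] − [b] ∈ KZ.relations`:
`B ∖ M ⊆ {p last = 0}` is null (rule (1): `[B, 2ρ] − [m]` is a relation), and one Newton–Leibniz move
along the last coordinate with primitive `F p = (p last)²`, `∂F/∂t = 2t` on the open fibres and
`F (x, β x) − F (x, α x) = β x² − α x²`, gives `[B, 2ρ] − [τ, β² − α²] ∈ KZ.newtonLeibnizRel`.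
[cite: KontsevichZagier2001, §1.2 rule (3)] -/
theorem tateLifting_revolutionBand :
    ∀ (n : ℕ) (m : KZ.IntegralRep (n + 1)) (τ : Set (Fin n → ℝ)) (α β : (Fin n → ℝ) → ℝ),
      IsSemialgebraic ℚ τ → IsSemialgebraicFunOn ℚ τ α → IsSemialgebraicFunOn ℚ τ β →
      (∀ v ∈ τ, 0 ≤ α v) → (∀ v ∈ τ, α v ≤ β v) →
      m.domain = {p | (Fin.init p : Fin n → ℝ) ∈ τ ∧ 0 < p (Fin.last n) ∧
        α (Fin.init p) ≤ p (Fin.last n) ∧ p (Fin.last n) ≤ β (Fin.init p)} →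
      Set.EqOn m.integrand (fun p => 2 * p (Fin.last n)) m.domain →
      ∃ b : KZ.IntegralRep n, b.domain = τ ∧ (b.integrand = fun v => β v ^ 2 - α v ^ 2) ∧
        KZ.of m - KZ.of b ∈ KZ.relations := by
  intro n m τ α β hτ hα hβ hα0 hαβ hdom hint
  -- the full band `B = KZlog.band τ α β ⊇ M`, and `B ∖ M ⊆ {p last = 0}` is null
  have hBsa : IsSemialgebraic ℚ (KZlog.band τ α β) := KZlog.isSemialgebraic_band hα hβ
  have hBm : MeasurableSet (KZlog.band τ α β) := IsSemialgebraic.measurableSet_holds hBsa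
  have hτm : MeasurableSet τ := IsSemialgebraic.measurableSet_holds hτ
  have hMm : MeasurableSet m.domain := KZ.IntegralRep.measurableSet_domain_holds m
  have hMB : m.domain ⊆ KZlog.band τ α β := by
    rw [hdom]
    exact fun p hp => KZlog.mem_band.2 ⟨hp.1, hp.2.2⟩
  have hdiff : KZlog.band τ α β \ m.domain ⊆ {p | p (Fin.last n) = 0} := by
    intro p hp
    have h1 : Fin.init p ∈ τ := (KZlog.mem_band.1 hp.1).1
    have h2 : α (Fin.init p) ≤ p (Fin.last n) := (KZlog.mem_band.1 hp.1).2.1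
    have h3 : p (Fin.last n) ≤ β (Fin.init p) := (KZlog.mem_band.1 hp.1).2.2
    have hnot : ¬ 0 < p (Fin.last n) := fun hpos => hp.2 (by rw [hdom]; exact ⟨h1, hpos, h2, h3⟩)
    exact le_antisymm (not_lt.1 hnot) ((hα0 _ h1).trans h2)
  have hnull : volume (KZlog.band τ α β \ m.domain) = 0 :=
    measure_mono_null hdiff (KZ.volume_setOf_last_eq_zero 0)
  -- the honest band representation `mB = [B, 2ρ]`
  have hGsa : IsSemialgebraicFunOn ℚ (KZlog.band τ α β) fun p => 2 * p (Fin.last n) :=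
    (isSemialgebraicFunOn_const_ofNat hBsa 2).fun_mul (isSemialgebraicFunOn_apply hBsa (Fin.last n))
  have hGint : IntegrableOn (fun p : Fin (n + 1) → ℝ => 2 * p (Fin.last n)) (KZlog.band τ α β) := by
    have h1 : IntegrableOn (fun p : Fin (n + 1) → ℝ => 2 * p (Fin.last n)) m.domain :=
      m.integrableOn.congr_fun hint hMm
    have h2 : IntegrableOn (fun p : Fin (n + 1) → ℝ => 2 * p (Fin.last n))
        (KZlog.band τ α β \ m.domain) := by
      rw [IntegrableOn, Measure.restrict_eq_zero.2 hnull]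
      exact integrable_zero_measure
    rw [← Set.union_sdiff_cancel hMB]
    exact h1.union h2
  let mB : KZ.IntegralRep (n + 1) :=
    ⟨KZlog.band τ α β, fun p => 2 * p (Fin.last n), hBsa, hGsa, hGint⟩
  -- `[mB] − [m] ∈ relations`: split off the null piece, then congruence on `M`
  have hrel1 : KZ.of mB - KZ.of m ∈ KZ.relations := by
    have h1 := KZ.IntegralRep.of_sub_of_restrict_mem_relations mB m.isSemialgebraic_domain hMB hnull
    have h2 : KZ.of (mB.restrict m.domain m.isSemialgebraic_domain hMB) - KZ.of m ∈ KZ.relations :=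
      KZ.of_sub_of_mem_relations_of_eqOn (r := mB.restrict m.domain m.isSemialgebraic_domain hMB)
        (r' := m) rfl fun p hp => (hint hp).symm
    have h := KZ.relations.add_mem h1 h2
    rwa [sub_add_sub_cancel] at h
  -- honesty of the base representation `b = [τ, β² − α²]`
  have hbsa : IsSemialgebraicFunOn ℚ τ fun v => β v ^ 2 - α v ^ 2 :=
    (hβ.fun_pow 2).fun_sub (hα.fun_pow 2)
  have hbint : IntegrableOn (fun v => β v ^ 2 - α v ^ 2) τ := by
    refine ⟨KZ.aestronglyMeasurable_of_isSemialgebraicFunOn hbsa hτm, ?_⟩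
    rw [hasFiniteIntegral_iff_ofReal ((ae_restrict_mem hτm).mono fun v hv =>
      sub_nonneg.2 (pow_le_pow_left₀ (hα0 v hv) (hαβ v hv) 2)),
      RevolutionBand.lintegral_sq_sub_sq_eq hτm hα0 hαβ hBm rfl]
    calc ∫⁻ p in KZlog.band τ α β, ENNReal.ofReal (2 * p (Fin.last n))
        ≤ ∫⁻ p in KZlog.band τ α β, ‖2 * p (Fin.last n)‖ₑ :=
          lintegral_mono fun p => Real.ofReal_le_enorm _
      _ < ⊤ := hGint.2
  let b : KZ.IntegralRep n := ⟨τ, fun v => β v ^ 2 - α v ^ 2, hτ, hbsa, hbint⟩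
  -- `[mB] − [b] ∈ relations`: one Newton–Leibniz move with primitive `F p = (p last)²`
  have hrel2 : KZ.of mB - KZ.of b ∈ KZ.relations := by
    refine KZ.newtonLeibnizRel_subset_relations ⟨n, mB, b, α, β, fun p => p (Fin.last n) ^ 2,
      (isSemialgebraicFunOn_apply hBsa (Fin.last n)).fun_pow 2, hα, hβ, hαβ, rfl,
      fun x _ => ?_, fun x _ t _ => ?_, fun x _ => ?_, rfl⟩
    · -- `t ↦ F (x, t) = t²` is continuous on the closed fibre
      simp only [Fin.snoc_last]
      exact (continuous_pow 2).continuousOn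
    · -- `∂/∂t F (x, t) = 2t = mB.integrand (x, t)` on the open fibre
      show HasDerivAt (fun s : ℝ => (Fin.snoc x s : Fin (n + 1) → ℝ) (Fin.last n) ^ 2)
        (2 * (Fin.snoc x t : Fin (n + 1) → ℝ) (Fin.last n)) t
      simp only [Fin.snoc_last]
      simpa using hasDerivAt_pow 2 t
    · -- `b.integrand x = F (x, β x) - F (x, α x)`
      simp only [Fin.snoc_last, b]
  refine ⟨b, rfl, rfl, ?_⟩
  have h := KZ.relations.sub_mem hrel2 hrel1
  rwa [sub_sub_sub_cancel_left] at h

end Summit.KontsevichZagierPeriods.InverseLandau
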